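import Summits.QuantumFields.YangMills.Theorems.BalabanUVNodesN22KnitTwoConstants
import Literature.MathematicalPhysics.QuantumFieldTheory.Balaban1983to89.B12Eq213AnalyticHistory

/-!
# BalabanUVNodes ∕ N22 knit, ROAD 3 IN THE STRIP ∕ DERIVATIVE-LETTER CURRENCY — node N22 = `NE9 ∧ FadingMemory` BY NAME from (P) + (O)
# (node N18's tower rate `θ`) + analyticity of the young-coupling sections on a FIXED complex neighbourhood of the window with a DERIVATIVE
# letter `‖F′‖ ≤ L·μ^{age}·e^{−κd}` growing at ANY geometric rate `μ` — the exact output shape of the twin seat's analytic history tower on the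
# (2.13) body (`B12Eq213AnalyticHistory.analyticHistory_letters`: fixed strip, `‖∂_z‖ ≤ Λ₀∕(cos m)^{age}`), read here BY NAME (Track A, DAG
# node N22 = NE9; cluster K4 «SpineRates»; seat `pub-ymgap-dag-n22-a`, generation 3, successor trigger (t2) of its HANDOFF)

HONEST FRAMING.  §1 is one-variable complex analysis ([folklore]); §2 is count-neutral kernel bookkeeping over hypothesis shapes on the ABSTRACT
carriers `T4OutputRate.Carriers` and ne9's tower of carriers; §3 re-reads the twin seat's body-level letters (the (W2) closers at K4's `U3Carriers` are
the companion `BalabanUVNodesN22AtRecordStrip`).  NOT a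
node discharge; NE5 ∕ NE9 NOT IN PRINT, NOT PROVED; instance on Bałaban's localized `E^{(j)}(X)` 0∕1 (wall W1 = localization, unchanged); no `RRec`
home exists (R422 (A)(P2)); one finite four-torus programme at fixed ε; nothing continuum ∕ ℝ⁴ ∕ OS ∕ mass-gap ∕ Clay.  0 `sorry`, 0 `def`, standard
axioms.  `--supports` item `SpineGivenEndpoint` (route «BalabanUVNodes», cluster K4).

WHY THIS CURRENCY.  ROAD 3's headline `BalabanUVNodesN22KnitTwoConstants.ne9_and_fadingMemory_of_osc_analytic_rpow` asks for the (A) letter with an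
UNCENTRED sup bound `‖F‖ ≤ M·μ^{age}·e^{−κd(X)}` on the complex discs — natural for the LOCALIZED terms (which are themselves `O(e^{−κd})`, (1.18)),
but not what the body-level producer delivers: on the un-localised (2.13) body the twin seat's module 13 (`B12Eq213AnalyticHistory`, p421841 +
v1.1∕v1.2) proves, for each OLDER coupling `g_i` and every age, holomorphy of `z ↦ 𝐄_k(g with g_i := z; U)` on ONE open convex `O ⊆ ℂ` (the strip
never shrinks with the age) with a DERIVATIVE letter `‖∂_z 𝐄_k‖ ≤ Λ₀∕(cos m)^{k−1−i}` and real compatibility — a CENTRED currency (the total action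
is extensive; only its differences and derivatives are bounded).  This file runs ROAD 3 in exactly that currency:
* §1 `norm_sub_center_le_of_derivLetter` (mean value on a disc), **`norm_deriv_le_twoConstants_oneSided_of_derivLetter`** — `F` analytic on
  `D(x₀, R)` with `‖F′‖ ≤ L` there, flat on ONE side (`|F(x₀ ± u) − F(x₀)| ≤ ε`, `u ∈ [0, r]`, `r < R`), `0 < ε ≤ 2LR`, `0 < s < 1` ⟹
  `‖F′(x₀)‖ ≤ (32∕(s²r))·ε^{1−s}·(2LR)^{s}` (the two-constants bound of `N22KnitTwoConstants` applied to `F − F(x₀)`).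
* §2 ON THE ABSTRACT CARRIERS: `coordLipschitzOn_of_osc_strip` — (O) oscillation fading (`C₀θ^{age}`) + (A′) every young-coupling section extends
  analytically to a set containing the OPEN discs of radius `r` about `]0, γ]` with `‖F′‖ ≤ L·μ^{scale X − 1 − i}·e^{−κd(X)}` there (`θ ≤ μ`,
  `C₀ ≤ 2Lr`) ⟹ `CoordLipschitzOn ]0, γ]` with moduli `Λ k i = C₉·τ_s^{k−i}`, `τ_s = θ^{1−s}μ^{s}`, `C₉ = (32∕(s²·r₁))·C₀^{1−s}(2Lr)^{s}∕τ_s`,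
  `r₁ = min(r∕2, γ∕2)`, EVERY `s ∈ ]0, 1[`; **`ne9_and_fadingMemory_of_osc_strip`** — with (P): node N22's statement of record BY NAME, fading at
  every rate above `θ` whatever the growth `μ`; `ne9_fadingMemory_at_level_of_ne5_below_strip` — along ne9's tower with node N18 below the level.
* §3 THE BODY'S LETTERS ARE (A′)-LETTERS, BY NAME: `stripLetters_of_analyticHistory` — the conclusion of `analyticHistory_letters` (equivalently the
  hypothesis of `norm_sub_real_le_of_letters`) repackaged literally as the three clauses of (A′) at `L = Λ₀`, `μ = (cos m)⁻¹`, weight `1`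
  (un-localised: no `e^{−κd}`); `one_le_inv_cos` records `μ = (cos m)⁻¹ ≥ 1 > θ`, so §2's side condition `θ ≤ μ` is automatic on the body;
  `norm_sub_center_le_of_analyticHistory` — the centred sup letter on the body's discs (companion of module 13's vertical estimate).
READING (census v1.4 row ROAD 3∕strip).  What an instancing record must carry for N22 on this road: (P) (printed words, p. 256); (O) = node N18 along
the tower (in-edge); (A′) = the printed TYPE «(or analytic)» ([Balaban1987RG1] p. 263; p. 266 after (2.9), plural) in EACH young coupling on a
complex neighbourhood containing discs of a FIXED radius about the whole window `]0, γ]`, with a derivative letter of at-most-geometric growth —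
body-level: module 13 (fixed strip, growth `(cos m)^{−1}` per step, birth letter from exponent-level letters, its §4∕§5); LOCALIZED with the
weights `e^{−κd(X)}`: the object W1 ([Balaban1988RG2Cluster] §§1–2), not here.  VERTEX: the fixed radius `r` down to `t → 0⁺` is load-bearing —
on (2.9)'s RELATIVE discs `D(t, c·t)` a derivative letter is the centred shape with LINEAR vanishing order (`p = 1`), for which (O) + analyticity
give NO fading (`BalabanUVNodesN22KnitVertexWitness`, kernel witness); nothing in this file weakens that verdict.

References (TYPES only): [Balaban1987RG1] = T. Bałaban, Commun. Math. Phys. **109** (1987) 249–301 — p. 256, Thm 1 p. 259, (1.18) and the C^∞ ∕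
analytic clause p. 263, (2.9) p. 266, (2.13) p. 268, p. 298; [Balaban1988RG2Cluster] = T. Bałaban, Commun. Math. Phys. **116** (1988) 1–22 — §§1–2.
-/

noncomputable section

namespace Summit.QuantumFields.YangMills.BalabanUVNodes.N22KnitStrip

open Set Metric Complex Real Filter
open scoped Real Topology
open Summit.QuantumFields.YangMills.BalabanUVNodes.N22KnitTwoConstants
  (norm_deriv_le_twoConstants_oneSided interp_geometric)

/-! ## §1 The two-constants derivative bound in the derivative-letter (centred) currency -/

/-- **MEAN VALUE ON A DISC**: `F` complex-differentiable on `D(c, R)` with `‖F′‖ ≤ L` there gives `‖F z − F c‖ ≤ L·R` for `z ∈ D(c, R)` — a derivative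
letter is a CENTRED sup letter on every disc of the neighbourhood. [folklore] -/
theorem norm_sub_center_le_of_derivLetter {F : ℂ → ℂ} {c : ℂ} {R L : ℝ}
    (hF : DifferentiableOn ℂ F (ball c R)) (hL : ∀ z ∈ ball c R, ‖deriv F z‖ ≤ L) {z : ℂ} (hz : z ∈ ball c R) :
    ‖F z - F c‖ ≤ L * R := by
  have hzR : dist z c < R := mem_ball.1 hz
  have hR : 0 < R := lt_of_le_of_lt dist_nonneg hzR
  have hc : c ∈ ball c R := mem_ball_self hR
  have hL0 : 0 ≤ L := (norm_nonneg _).trans (hL c hc)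
  have hdiff : ∀ x ∈ ball c R, DifferentiableAt ℂ F x := fun x hx => hF.differentiableAt (isOpen_ball.mem_nhds hx)
  have h : ‖F z - F c‖ ≤ L * ‖z - c‖ := (convex_ball c R).norm_image_sub_le_of_norm_deriv_le hdiff hL hc hz
  have hzc : ‖z - c‖ ≤ R := by rw [← dist_eq_norm]; exact hzR.le
  exact h.trans (mul_le_mul_of_nonneg_left hzc hL0)

/-- **THE ONE-SIDED TWO-CONSTANTS DERIVATIVE BOUND FROM A DERIVATIVE LETTER.**  `F` complex-differentiable on `D(x₀, R)` (`x₀` real) with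
`‖F′‖ ≤ L` there; on ONE side of `x₀` along the real axis, `|F(x₀ + σu) − F(x₀)| ≤ ε` for `u ∈ [0, r]` (`σ = ±1`, `0 < r < R`); `0 < ε ≤ 2LR`;
`0 < s < 1`.  Then **`‖F′(x₀)‖ ≤ (32∕(s²·r))·ε^{1−s}·(2LR)^{s}`** — `N22KnitTwoConstants.norm_deriv_le_twoConstants_oneSided` applied to the centred
function `F − F(x₀)`, whose disc bound is `LR` by `norm_sub_center_le_of_derivLetter`. [folklore] -/
theorem norm_deriv_le_twoConstants_oneSided_of_derivLetter {F : ℂ → ℂ} {x₀ r R L ε s σ : ℝ} (hσ : σ = 1 ∨ σ = -1)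
    (hr : 0 < r) (hrR : r < R) (hs0 : 0 < s) (hs1 : s < 1) (hε : 0 < ε) (hεB : ε ≤ 2 * (L * R))
    (hF : DifferentiableOn ℂ F (ball (x₀ : ℂ) R)) (hL : ∀ z ∈ ball (x₀ : ℂ) R, ‖deriv F z‖ ≤ L)
    (hflat : ∀ u : ℝ, 0 ≤ u → u ≤ r → ‖F ((x₀ + σ * u : ℝ) : ℂ) - F x₀‖ ≤ ε) :
    ‖deriv F x₀‖ ≤ 32 / (s ^ 2 * r) * ε ^ (1 - s) * (2 * (L * R)) ^ s := by
  set F₁ : ℂ → ℂ := fun z => F z - F x₀ with hF₁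
  have hF₁d : DifferentiableOn ℂ F₁ (ball (x₀ : ℂ) R) := hF.sub_const _
  have hB : ∀ z ∈ ball (x₀ : ℂ) R, ‖F₁ z‖ ≤ L * R := fun z hz => norm_sub_center_le_of_derivLetter hF hL hz
  have hflat₁ : ∀ u : ℝ, 0 ≤ u → u ≤ r → ‖F₁ ((x₀ + σ * u : ℝ) : ℂ) - F₁ x₀‖ ≤ ε := by
    intro u hu0 hur
    have e : F₁ ((x₀ + σ * u : ℝ) : ℂ) - F₁ x₀ = F ((x₀ + σ * u : ℝ) : ℂ) - F x₀ := sub_sub_sub_cancel_right _ _ _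
    rw [e]
    exact hflat u hu0 hur
  have hd : deriv F₁ x₀ = deriv F x₀ := deriv_sub_const (F x₀)
  rw [← hd]
  exact norm_deriv_le_twoConstants_oneSided hσ hr hrR hs0 hs1 hε hεB hF₁d hB hflat₁

/-! ## §2 On the abstract carriers: node N22 from (P) + (O) + a derivative letter on a fixed complex neighbourhood of the window -/

section Abstract

open Literature.MathematicalPhysics.QuantumFieldTheory.Balaban1983to89
open Literature.MathematicalPhysics.QuantumFieldTheory.Balaban1983to89.T4OutputRate
open Literature.MathematicalPhysics.QuantumFieldTheory.Balaban1983to89.T4CouplingAnalyticity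
  (CoordLipschitzOn update_mem_boxWindow ne9_of_coordLipschitz)
open Summit.QuantumFields.YangMills.BalabanUVNodes.N22Knit (fadingMemory_geometric)
open Summit.QuantumFields.YangMills.BalabanUVNodes.N22KnitFiniteTower (oscFading_of_ne5_below)
open Summit.QuantumFields.BalabanUV.T4Continuum.NE9.TowerCarriers (TowerData prepend)

variable {C : Carriers} {Bg : Type} {E : Functional C Bg}

/-- **(O) + A DERIVATIVE LETTER ON A FIXED NEIGHBOURHOOD WITH GEOMETRIC GROWTH ⇒ COORDINATEWISE FADING LIPSCHITZ MODULI AT THE RATE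
`θ^{1−s}μ^{s}`.**  (O) oscillation fading with constant `C₀ > 0` and rate `θ > 0`; (A′) every young-coupling section `t ↦ E (update g i t) U X` on
`]0, γ]` extends to a complex-differentiable `F` on a set `D` containing the OPEN discs of radius `r` about the points of `]0, γ]`, with the
derivative letter `‖F′ z‖ ≤ L·μ^{scale X − 1 − i}·e^{−κd(X)}` on `D` (`θ ≤ μ`, `C₀ ≤ 2Lr`: enlarge `L`, `μ` if needed).  Then for every `s ∈ ]0, 1[`:
`CoordLipschitzOn ]0, γ] E κ Λ`, `Λ k i = C₉·τ_s^{k−i}`, `τ_s = θ^{1−s}μ^{s}`, `C₉ = (32∕(s²·r₁))·C₀^{1−s}(2Lr)^{s}∕τ_s`, `r₁ = min(r∕2, γ∕2)` — §1 at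
every point of the window, one-sided towards the interior, then the mean value inequality (proof pattern of
`N22KnitTwoConstants.coordLipschitzOn_of_osc_analytic_rpow`, with `M := L·r`). [folklore] -/
theorem coordLipschitzOn_of_osc_strip {γ κ C₀ θ L μ r s : ℝ}
    (hO : ∀ g ∈ Window γ, ∀ g' ∈ Window γ, ∀ (U : Bg) (X : C.Dom) (a : ℕ), a ≤ C.scale X →
      (∀ n, a ≤ n → g n = g' n) → |E g U X - E g' U X| ≤ C₀ * θ ^ (C.scale X - a) * Real.exp (-(κ * C.d X)))
    (hA : ∀ g ∈ Window γ, ∀ (U : Bg) (X : C.Dom) (i : ℕ), i < C.scale X → ∃ (F : ℂ → ℂ) (D : Set ℂ),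
      DifferentiableOn ℂ F D ∧ (∀ z ∈ D, ‖deriv F z‖ ≤ L * μ ^ (C.scale X - 1 - i) * Real.exp (-(κ * C.d X))) ∧
      (∀ t ∈ Ioc (0 : ℝ) γ, ball (t : ℂ) r ⊆ D) ∧ (∀ t ∈ Ioc (0 : ℝ) γ, F t = (E (Function.update g i t) U X : ℂ)))
    (hC₀ : 0 < C₀) (hθ : 0 < θ) (hL : 0 < L) (hθμ : θ ≤ μ) (hCL : C₀ ≤ 2 * (L * r)) (hr : 0 < r) (hγ : 0 < γ)
    (hs0 : 0 < s) (hs1 : s < 1) :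
    CoordLipschitzOn (Ioc (0 : ℝ) γ) E κ
      (fun k i => 32 / (s ^ 2 * min (r / 2) (γ / 2)) * (C₀ ^ (1 - s) * (2 * (L * r)) ^ s) / (θ ^ (1 - s) * μ ^ s)
        * (θ ^ (1 - s) * μ ^ s) ^ (k - i)) := by
  intro U X g hg i hi s₁ hs₁ s₂ hs₂
  set a : ℕ := C.scale X - 1 - i with ha
  set w : ℝ := Real.exp (-(κ * C.d X)) with hw
  have hw0 : 0 < w := Real.exp_pos _
  have hμ : 0 < μ := hθ.trans_le hθμ
  have hM : 0 < L * r := mul_pos hL hr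
  set τ : ℝ := θ ^ (1 - s) * μ ^ s with hτ
  have hτ0 : 0 < τ := mul_pos (Real.rpow_pos_of_pos hθ _) (Real.rpow_pos_of_pos hμ _)
  set r₁ : ℝ := min (r / 2) (γ / 2) with hr₁
  have hr₁0 : 0 < r₁ := lt_min (by linarith) (by linarith)
  have hr₁r : r₁ < r := (min_le_left _ _).trans_lt (by linarith)
  have hr₁γ : 2 * r₁ ≤ γ := by have := min_le_right (r / 2) (γ / 2); linarith
  set ε : ℝ := C₀ * θ ^ a * w with hε
  set L' : ℝ := L * μ ^ a * w with hL'
  have hε0 : 0 < ε := by positivity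
  have hεB : ε ≤ 2 * (L' * r) := by
    have h1 : θ ^ a ≤ μ ^ a := pow_le_pow_left₀ hθ.le hθμ a
    have h2 : C₀ * θ ^ a ≤ 2 * (L * r) * μ ^ a := mul_le_mul hCL h1 (pow_nonneg hθ.le a) (by positivity)
    calc ε = C₀ * θ ^ a * w := rfl
      _ ≤ 2 * (L * r) * μ ^ a * w := mul_le_mul_of_nonneg_right h2 hw0.le
      _ = 2 * (L' * r) := by rw [hL']; ring
  obtain ⟨F, D, hF, hFL, hD, hf⟩ := hA g hg U X i hi
  set f : ℝ → ℝ := fun t => E (Function.update g i t) U X with hfdef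
  have hflat : ∀ x ∈ Ioc (0 : ℝ) γ, ∀ y ∈ Ioc (0 : ℝ) γ, |f x - f y| ≤ ε := by
    intro x hx y hy
    have hagree : ∀ n, i + 1 ≤ n → Function.update g i x n = Function.update g i y n := fun n hn => by
      have hni : n ≠ i := by omega
      rw [Function.update_of_ne hni, Function.update_of_ne hni]
    have h := hO _ (update_mem_boxWindow hg i hx) _ (update_mem_boxWindow hg i hy) U X (i + 1) (by omega) hagree
    rwa [show C.scale X - (i + 1) = a by omega] at h
  set Lip : ℝ := 32 / (s ^ 2 * r₁) * ε ^ (1 - s) * (2 * (L' * r)) ^ s with hLip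
  have hderiv : ∀ t ∈ Ioc (0 : ℝ) γ, ‖deriv F t‖ ≤ Lip := by
    intro t ht
    have hball : ball (t : ℂ) r ⊆ D := hD t ht
    have hFt : DifferentiableOn ℂ F (ball (t : ℂ) r) := hF.mono hball
    have hLt : ∀ z ∈ ball (t : ℂ) r, ‖deriv F z‖ ≤ L' := fun z hz => hFL z (hball hz)
    by_cases htr : t + r₁ ≤ γ
    · refine norm_deriv_le_twoConstants_oneSided_of_derivLetter (σ := 1) (Or.inl rfl) hr₁0 hr₁r hs0 hs1 hε0 hεB hFt hLt
        fun u hu0 hur => ?_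
      have hmem : t + 1 * u ∈ Ioc (0 : ℝ) γ := ⟨by linarith [ht.1], by linarith⟩
      rw [hf _ hmem, hf _ ht, ← Complex.ofReal_sub, Complex.norm_real, Real.norm_eq_abs]
      exact hflat _ hmem _ ht
    · have htr : γ < t + r₁ := not_le.mp htr
      refine norm_deriv_le_twoConstants_oneSided_of_derivLetter (σ := -1) (Or.inr rfl) hr₁0 hr₁r hs0 hs1 hε0 hεB hFt hLt
        fun u hu0 hur => ?_
      have hmem : t + -1 * u ∈ Ioc (0 : ℝ) γ := ⟨by linarith, by linarith [ht.2]⟩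
      rw [hf _ hmem, hf _ ht, ← Complex.ofReal_sub, Complex.norm_real, Real.norm_eq_abs]
      exact hflat _ hmem _ ht
  have hfd : ∀ t ∈ Ioc (0 : ℝ) γ, HasDerivWithinAt f ((deriv F t).re) (Ioc (0 : ℝ) γ) t := by
    intro t ht
    have hDt : D ∈ 𝓝 (t : ℂ) := mem_nhds_iff.mpr ⟨ball (t : ℂ) r, hD t ht, isOpen_ball, mem_ball_self hr⟩
    have h1 : HasDerivAt F (deriv F t) (t : ℂ) := (hF.differentiableAt hDt).hasDerivAt
    have h2 : HasDerivAt (fun x : ℝ => (F x).re) (deriv F t).re t := h1.real_of_complex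
    refine h2.hasDerivWithinAt.congr (fun x hx => ?_) ?_
    · show f x = (F x).re
      rw [hf x hx, Complex.ofReal_re]
    · show f t = (F t).re
      rw [hf t ht, Complex.ofReal_re]
  have hmv : ∀ x y : ℝ, x ∈ Ioc (0 : ℝ) γ → y ∈ Ioc (0 : ℝ) γ → x ≤ y → |f y - f x| ≤ Lip * (y - x) := by
    intro x y hx hy hxy
    have hsub : Icc x y ⊆ Ioc (0 : ℝ) γ := fun z hz => ⟨hx.1.trans_le hz.1, hz.2.trans hy.2⟩
    have h := norm_image_sub_le_of_norm_deriv_le_segment' (f := f) (f' := fun t => (deriv F t).re)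
      (fun z hz => (hfd z (hsub hz)).mono hsub)
      (fun z hz => ((Complex.abs_re_le_norm _).trans (hderiv z (hsub (Ico_subset_Icc_self hz)))))
      y (right_mem_Icc.mpr hxy)
    rw [Real.norm_eq_abs] at h
    exact h
  have hmain : |f s₁ - f s₂| ≤ Lip * |s₁ - s₂| := by
    rcases le_total s₁ s₂ with h | h
    · rw [abs_sub_comm (f s₁) (f s₂), abs_sub_comm s₁ s₂, abs_of_nonneg (sub_nonneg.mpr h)]
      exact hmv s₁ s₂ hs₁ hs₂ h
    · rw [abs_of_nonneg (sub_nonneg.mpr h)]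
      exact hmv s₂ s₁ hs₂ hs₁ h
  have hscale : C.scale X - i = a + 1 := by omega
  have hLipeq : Lip = w * (32 / (s ^ 2 * r₁) * (C₀ ^ (1 - s) * (2 * (L * r)) ^ s) / τ * τ ^ (C.scale X - i)) := by
    rw [hLip, hscale, pow_succ τ a, hε, show 2 * (L' * r) = 2 * (L * r) * μ ^ a * w by rw [hL']; ring,
      mul_assoc (32 / (s ^ 2 * r₁)), interp_geometric hC₀ hM hθ hμ hw0 a]
    field_simp
    ring
  show |f s₁ - f s₂| ≤ w * (32 / (s ^ 2 * r₁) * (C₀ ^ (1 - s) * (2 * (L * r)) ^ s) / τ * τ ^ (C.scale X - i) * |s₁ - s₂|)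
  calc |f s₁ - f s₂| ≤ Lip * |s₁ - s₂| := hmain
    _ = w * (32 / (s ^ 2 * r₁) * (C₀ ^ (1 - s) * (2 * (L * r)) ^ s) / τ * τ ^ (C.scale X - i) * |s₁ - s₂|) := by
        rw [hLipeq]; ring

/-- **ROAD 3 IN THE STRIP CURRENCY — NODE N22 FROM (P) + (O) + A DERIVATIVE LETTER ON A FIXED NEIGHBOURHOOD, ANY GEOMETRIC GROWTH.**  (P)
prefix dependence ([Balaban1987RG1] p. 256, words); (O) oscillation fading with constant `C₀ > 0` at the tower rate `θ > 0` (= node N18 along the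
tower, NOT PRINTED); (A′) every young-coupling section extends analytically to a set containing the open discs of radius `r` about `]0, γ]`, with the
derivative letter `‖F′‖ ≤ L·μ^{age−1}·e^{−κd(X)}`, ANY `μ ≥ θ` (`C₀ ≤ 2Lr`) — the TYPE of p. 263's «(or analytic)», in the centred currency the
(2.13) body delivers for the older couplings (`B12Eq213AnalyticHistory.analyticHistory_letters`, §3 below).  Then for EVERY `s ∈ ]0, 1[`:
**`NE9 E (Window γ) κ Λ ∧ FadingMemory C₉ τ_s Λ`**, `Λ k i = C₉·τ_s^{k−i}`, `τ_s = θ^{1−s}μ^{s}`,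
`C₉ = (32∕(s²·min(r∕2, γ∕2)))·C₀^{1−s}(2Lr)^{s}∕τ_s` — node N22's statement of record BY NAME with fading at every rate above `θ` (`s ↓ 0`),
WHATEVER the growth `μ`; only node N18's `θ < 1` makes `τ_s < 1`. [folklore] -/
theorem ne9_and_fadingMemory_of_osc_strip {γ κ C₀ θ L μ r s : ℝ} (hP : PrefixDependenceOn E (Window γ))
    (hO : ∀ g ∈ Window γ, ∀ g' ∈ Window γ, ∀ (U : Bg) (X : C.Dom) (a : ℕ), a ≤ C.scale X →
      (∀ n, a ≤ n → g n = g' n) → |E g U X - E g' U X| ≤ C₀ * θ ^ (C.scale X - a) * Real.exp (-(κ * C.d X)))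
    (hA : ∀ g ∈ Window γ, ∀ (U : Bg) (X : C.Dom) (i : ℕ), i < C.scale X → ∃ (F : ℂ → ℂ) (D : Set ℂ),
      DifferentiableOn ℂ F D ∧ (∀ z ∈ D, ‖deriv F z‖ ≤ L * μ ^ (C.scale X - 1 - i) * Real.exp (-(κ * C.d X))) ∧
      (∀ t ∈ Ioc (0 : ℝ) γ, ball (t : ℂ) r ⊆ D) ∧ (∀ t ∈ Ioc (0 : ℝ) γ, F t = (E (Function.update g i t) U X : ℂ)))
    (hC₀ : 0 < C₀) (hθ : 0 < θ) (hL : 0 < L) (hθμ : θ ≤ μ) (hCL : C₀ ≤ 2 * (L * r)) (hr : 0 < r) (hγ : 0 < γ)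
    (hs0 : 0 < s) (hs1 : s < 1) :
    NE9 E (Window γ) κ
        (fun k i => 32 / (s ^ 2 * min (r / 2) (γ / 2)) * (C₀ ^ (1 - s) * (2 * (L * r)) ^ s) / (θ ^ (1 - s) * μ ^ s)
          * (θ ^ (1 - s) * μ ^ s) ^ (k - i)) ∧
      FadingMemory (32 / (s ^ 2 * min (r / 2) (γ / 2)) * (C₀ ^ (1 - s) * (2 * (L * r)) ^ s) / (θ ^ (1 - s) * μ ^ s))
        (θ ^ (1 - s) * μ ^ s)
        (fun k i => 32 / (s ^ 2 * min (r / 2) (γ / 2)) * (C₀ ^ (1 - s) * (2 * (L * r)) ^ s) / (θ ^ (1 - s) * μ ^ s)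
          * (θ ^ (1 - s) * μ ^ s) ^ (k - i)) := by
  have hμ : 0 < μ := hθ.trans_le hθμ
  have hτ0 : 0 < θ ^ (1 - s) * μ ^ s := mul_pos (Real.rpow_pos_of_pos hθ _) (Real.rpow_pos_of_pos hμ _)
  have hr₁0 : 0 < min (r / 2) (γ / 2) := lt_min (by linarith) (by linarith)
  have hC₉ : 0 ≤ 32 / (s ^ 2 * min (r / 2) (γ / 2)) * (C₀ ^ (1 - s) * (2 * (L * r)) ^ s) / (θ ^ (1 - s) * μ ^ s) := by
    have h1 : 0 ≤ C₀ ^ (1 - s) := Real.rpow_nonneg hC₀.le _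
    have h2 : 0 ≤ (2 * (L * r)) ^ s := Real.rpow_nonneg (by positivity) _
    positivity
  exact ⟨ne9_of_coordLipschitz hP (coordLipschitzOn_of_osc_strip hO hA hC₀ hθ hL hθμ hCL hr hγ hs0 hs1),
    fadingMemory_geometric hC₉ hτ0.le⟩

/-- **ROAD 3 IN THE STRIP CURRENCY ALONG ne9's TOWER OF CARRIERS — NODE N22 FOR THE RUN OF LENGTH `k` FROM NODE N18 BELOW `k`.**
`T4OutputRate.NE5` at the pairs of run lengths `k′ < k` (node N18 BY NAME, the finite datum; `C₅ > 0`, `0 < θ < 1`) gives (O) at level `k` with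
`C₀ = 2C₅∕(1−θ)` (`N22KnitFiniteTower.oscFading_of_ne5_below`); with (P) and (A′) for `E k` (derivative letter `L·μ^{(k − r X) − 1 − i}·e^{−κd(X)}`
on a set containing the open `r`-discs about the window, `μ ≥ θ`, `2C₅∕(1−θ) ≤ 2Lr`): for every `s ∈ ]0, 1[`,
`NE9 (C := T.level k) (E k) (Window γ) κ Λ ∧ FadingMemory C₉ τ_s Λ`, `τ_s = θ^{1−s}μ^{s}`. [folklore] -/
theorem ne9_fadingMemory_at_level_of_ne5_below_strip (T : TowerData) {E : ℕ → (ℕ → ℝ) → T.B → T.Dom → ℝ}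
    {γ κ θ C₅ L μ r s : ℝ} (hC : 0 < C₅) (hθ0 : 0 < θ) (hθ1 : θ < 1) (k : ℕ)
    (h5 : ∀ k' : ℕ, k' < k → ∀ b : ℝ, 0 < b → b ≤ γ →
      NE5 (C := T.level k') (E k') (fun g U X => E (k' + 1) (prepend b g) U X) (Window γ) κ θ C₅)
    (hP : PrefixDependenceOn (C := T.level k) (E k) (Window γ))
    (hA : ∀ g ∈ Window γ, ∀ (U : (T.level k).BgA) (X : (T.level k).Dom) (i : ℕ), i < (T.level k).scale X → ∃ (F : ℂ → ℂ) (D : Set ℂ),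
      DifferentiableOn ℂ F D ∧ (∀ z ∈ D, ‖deriv F z‖ ≤ L * μ ^ ((T.level k).scale X - 1 - i) * Real.exp (-(κ * (T.level k).d X))) ∧
      (∀ t ∈ Ioc (0 : ℝ) γ, ball (t : ℂ) r ⊆ D) ∧ (∀ t ∈ Ioc (0 : ℝ) γ, F t = (E k (Function.update g i t) U X : ℂ)))
    (hL : 0 < L) (hθμ : θ ≤ μ) (hCL : 2 * C₅ / (1 - θ) ≤ 2 * (L * r)) (hr : 0 < r) (hγ : 0 < γ) (hs0 : 0 < s) (hs1 : s < 1) :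
    NE9 (C := T.level k) (E k) (Window γ) κ
        (fun k i => 32 / (s ^ 2 * min (r / 2) (γ / 2)) * ((2 * C₅ / (1 - θ)) ^ (1 - s) * (2 * (L * r)) ^ s) / (θ ^ (1 - s) * μ ^ s)
          * (θ ^ (1 - s) * μ ^ s) ^ (k - i)) ∧
      FadingMemory (32 / (s ^ 2 * min (r / 2) (γ / 2)) * ((2 * C₅ / (1 - θ)) ^ (1 - s) * (2 * (L * r)) ^ s) / (θ ^ (1 - s) * μ ^ s))
        (θ ^ (1 - s) * μ ^ s)
        (fun k i => 32 / (s ^ 2 * min (r / 2) (γ / 2)) * ((2 * C₅ / (1 - θ)) ^ (1 - s) * (2 * (L * r)) ^ s) / (θ ^ (1 - s) * μ ^ s)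
          * (θ ^ (1 - s) * μ ^ s) ^ (k - i)) := by
  have h1θ : 0 < 1 - θ := by linarith
  have hC₀ : 0 < 2 * C₅ / (1 - θ) := by positivity
  exact ne9_and_fadingMemory_of_osc_strip (C := T.level k) hP (oscFading_of_ne5_below T hC.le hθ0.le hθ1 k h5) hA
    hC₀ hθ0 hL hθμ hCL hr hγ hs0 hs1

end Abstract

/-! ## §3 The (2.13) body's analytic history letters ARE (A′)-letters, by name -/

section Body

open Literature.MathematicalPhysics.QuantumFieldTheory.Balaban1983to89.B12Eq213AnalyticHistory (norm_sub_real_le_of_letters)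

variable {Y : Type*}

/-- The body's growth letter is at least one: `0 ≤ m < π∕2` gives `1 ≤ (cos m)⁻¹` — so §2's side condition `θ ≤ μ` holds on the body for every
tower rate `θ ≤ 1` with `μ = (cos m)⁻¹`. [folklore] -/
theorem one_le_inv_cos {m : ℝ} (hm0 : 0 ≤ m) (hm : m < π / 2) : 1 ≤ (Real.cos m)⁻¹ := by
  have hc : 0 < Real.cos m := Real.cos_pos_of_mem_Ioo ⟨by linarith [Real.pi_pos], hm⟩
  rw [le_inv_comm₀ one_pos hc, inv_one]
  exact Real.cos_le_one m

/-- **THE BODY'S LETTERS IN (A′)-FORM — [Balaban1987RG1] p. 266 *«𝐄^{(j)} … are analytic functions of the effective coupling constants»* FOR AN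
OLDER CONSTANT, ON THE BODY, READ BY NAME.**  The conclusion of the twin seat's `B12Eq213AnalyticHistory.analyticHistory_letters` (equivalently the
hypothesis `hletters` of its corollary `norm_sub_real_le_of_letters`) — for every age `k > i` and `U ∈ Dom k`: holomorphy of `z ↦ Ec k z U` on the
fixed `O`, the strip letter `|Im| ≤ m`, the derivative letter `Λ₀∕(cos m)^{k−(i+1)}`, real compatibility with the real history tower — IS, section by
section, the three clauses of §2's letter (A′) at `L = Λ₀`, `μ = (cos m)⁻¹` and weight `1` (un-localised: no `e^{−κd}`): an `F` complex-differentiable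
on `O` with `‖F′ z‖ ≤ Λ₀·((cos m)⁻¹)^{k − 1 − i}` on `O` and `F t = 𝐄_k(g with g_i := t; U)` at the real points of `O`.  With `O ⊇ ⋃_{t ∈ ]0,γ]} D(t, r)`
(a fixed margin about the WHOLE window, down to the vertex) this is exactly what `ne9_and_fadingMemory_of_osc_strip` consumes once localized (W1).
[cite: Balaban1987RG1, p.266 (after (2.9)), §0 (0.23) p.256 and p.263 (clause before (1.18))] -/
theorem stripLetters_of_analyticHistory (E : ℕ → (ℕ → ℝ) → Y → ℝ) (Ec : ℕ → ℂ → Y → ℂ) (Dom : ℕ → Set Y) (O : Set ℂ)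
    {m Λ₀ : ℝ} (g : ℕ → ℝ) (i : ℕ)
    (hletters : ∀ k, i < k → ∀ U ∈ Dom k,
      DifferentiableOn ℂ (fun z => Ec k z U) O ∧
      (∀ z ∈ O, |(Ec k z U).im| ≤ m) ∧
      (∀ z ∈ O, ‖deriv (fun z => Ec k z U) z‖ ≤ Λ₀ / Real.cos m ^ (k - (i + 1))) ∧
      (∀ t : ℝ, (t : ℂ) ∈ O → Ec k t U = E k (Function.update g i t) U)) :
    ∀ k, i < k → ∀ U ∈ Dom k, ∃ F : ℂ → ℂ,
      DifferentiableOn ℂ F O ∧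
      (∀ z ∈ O, ‖deriv F z‖ ≤ Λ₀ * (Real.cos m)⁻¹ ^ (k - 1 - i)) ∧
      (∀ t : ℝ, (t : ℂ) ∈ O → F t = (E k (Function.update g i t) U : ℂ)) := by
  intro k hk U hU
  obtain ⟨hdiff, -, hderiv, hreal⟩ := hletters k hk U hU
  refine ⟨fun z => Ec k z U, hdiff, fun z hz => ?_, fun t ht => hreal t ht⟩
  have e : k - 1 - i = k - (i + 1) := by omega
  rw [e, inv_pow, ← div_eq_mul_inv]
  exact hderiv z hz

/-- **COROLLARY (the centred sup letter on the body, by name)**: under the same letters, on every disc `D(t, R) ⊆ O` about a real point `t` of `O`,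
`‖Ec k z U − 𝐄_k(g with g_i := t; U)‖ ≤ (Λ₀·((cos m)⁻¹)^{k−1−i})·R` — §1's `norm_sub_center_le_of_derivLetter` on the body's section; the companion
of module 13's vertical estimate `norm_sub_real_le_of_letters` (`≤ Λ_k·|Im z|`). [cite: Balaban1987RG1, p.266 (after (2.9)) and §0 (0.23) p.256] -/
theorem norm_sub_center_le_of_analyticHistory (E : ℕ → (ℕ → ℝ) → Y → ℝ) (Ec : ℕ → ℂ → Y → ℂ) (Dom : ℕ → Set Y) (O : Set ℂ)
    {m Λ₀ : ℝ} (g : ℕ → ℝ) (i : ℕ)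
    (hletters : ∀ k, i < k → ∀ U ∈ Dom k,
      DifferentiableOn ℂ (fun z => Ec k z U) O ∧
      (∀ z ∈ O, |(Ec k z U).im| ≤ m) ∧
      (∀ z ∈ O, ‖deriv (fun z => Ec k z U) z‖ ≤ Λ₀ / Real.cos m ^ (k - (i + 1))) ∧
      (∀ t : ℝ, (t : ℂ) ∈ O → Ec k t U = E k (Function.update g i t) U))
    {k : ℕ} (hk : i < k) {U : Y} (hU : U ∈ Dom k) {t R : ℝ} (hball : ball (t : ℂ) R ⊆ O) (hR : 0 < R) {z : ℂ}
    (hz : z ∈ ball (t : ℂ) R) :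
    ‖Ec k z U - (E k (Function.update g i t) U : ℂ)‖ ≤ Λ₀ * (Real.cos m)⁻¹ ^ (k - 1 - i) * R := by
  obtain ⟨hdiff, -, hderiv, hreal⟩ := hletters k hk U hU
  have ht : (t : ℂ) ∈ O := hball (mem_ball_self hR)
  have e : k - 1 - i = k - (i + 1) := by omega
  have hL : ∀ w ∈ ball (t : ℂ) R, ‖deriv (fun z => Ec k z U) w‖ ≤ Λ₀ * (Real.cos m)⁻¹ ^ (k - 1 - i) := fun w hw => by
    rw [e, inv_pow, ← div_eq_mul_inv]
    exact hderiv w (hball hw)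
  rw [← hreal t ht]
  exact norm_sub_center_le_of_derivLetter (F := fun z => Ec k z U) (hdiff.mono hball) hL hz

end Body

end Summit.QuantumFields.YangMills.BalabanUVNodes.N22KnitStrip

end
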